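import Literature.NumberTheory.EllipticCurves.ZpExtensionGaloisTwistWeilDual
import Literature.NumberTheory.EllipticCurves.ZpExtensionGaloisTwistLevelDualGlobalProofs
import HarnessLib

/-!
# No twisted invariants in `Hom(ker π, μ)` from the Weil pairing and the vanishing of the `Gal(K̄/K_∞)`-fixed
# torsion points — the input `hinv` of the global dual level change (proofs)

Topic `NumberTheory/EllipticCurves`; namespace `WeierstrassCurve`. THEOREMS ONLY (no definition, no named fact, no
instance). Discharges the hypothesis `hinv` of `map_twistedTorsionInclDual_eq_zero_of_smul_eq_zero`
(`ZpExtensionGaloisTwistLevelDualGlobalProofs`) / `tower_of_uniform_exponent` (`ZpExtensionGaloisTwistTowerProofs`): «every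
`m ∈ Hom(E[p^J], μ_{p^J})` whose restriction to `ker π = E[p^{J−j}]` is invariant under the Tate-dual action of `Γ_K` on
`E[p^J](χ_u)^D` vanishes on `ker π`», from

* a Weil pairing `e` on `E[p^J]` (biadditive, `μ_{p^J}`-valued, non-degenerate, Galois-equivariant — the tree THEOREM
  `WeierstrassCurve.exists_weilPairing_holds`, Silverman III.8.1), through the Weil dual isomorphism
  `w : E[p^J](χ_{u'}) ⥲ E[p^J](χ_u)^D` (`W.twistedWeilDual`, `u u' ≡ 1 (mod p^J)`), and
* the vanishing of the `Gal(K̄/K_∞)`-fixed points of `E[p^J]` (`hfix`; Greenberg p. 123 «since `E(F)_p = 0`, `E(F_∞)_p = 0`,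
  hence `H⁰(F, A_s) = 0` for all `s`» — for `K = ℚ`, `p = 2`, good supersingular reduction the tree's
  `SignedTransportAtTwo.fixedPoints_kerSubgroup_eq_bot_of_goodSS`).

Proof: write `m = w T`; the hypothesis says `e(R, g★T − T) = 1` for all `R ∈ ker π = E[p^{J−j}]` and all `g` (`★` the
`χ_{u'}`-twisted action); as `ker π = p^j E[p^J]` (divisibility) and `e(p^j R₁, Q) = e(R₁, p^j Q)`, non-degeneracy gives
`p^j (g★T − T) = 0`, i.e. `p^j T` is `★`-invariant, hence fixed by `Gal(K̄/K_∞)` (where `★` is the plain action), hence `0`;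
so `T ∈ E[p^j] = p^{J−j}`-multiples… precisely `m(R) = e(R, T) = e(p^j R₁, T) = e(R₁, p^j T) = 1` on `ker π`.

References: R. Greenberg, LNM 1716 (1999), §4 pp. 123–124 [GreenbergLNM1716]; J. H. Silverman, *AEC* (2009), III.8.1
[SilvermanAEC2009]; J. S. Milne, *Arithmetic Duality Theorems* (2006), I §2 [MilneADT2006].
-/

noncomputable section

open CategoryTheory Field
open scoped ContRepresentation

universe u

namespace WeierstrassCurve

open Literature.NumberTheory.EllipticCurves Literature.NumberTheory.GaloisRepresentations
open Literature.NumberTheory.GaloisRepresentations.DiscreteGaloisModule (TateDual tateDual MuCarrier)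

variable {K : Type u} [Field K] [CharZero K] (W : WeierstrassCurve K) [W.IsElliptic] (p : ℕ) [Fact p.Prime]
  (κ : ZpExtension K p) {j J : ℕ} (hjJ : j ≤ J) {u u' : ℤ} (hu : (p : ℤ) ∣ u - 1) (hu' : (p : ℤ) ∣ u' - 1)
  (huu' : ((p : ℤ) ^ J) ∣ u * u' - 1)
  (e : W.geomTorsion ((p ^ J : ℕ) : ℤ) → W.geomTorsion ((p ^ J : ℕ) : ℤ) → AlgebraicClosure K)
  (hμ : ∀ S T, e S T ^ (p ^ J) = 1)
  (hadd₁ : ∀ S₁ S₂ T, e (S₁ + S₂) T = e S₁ T * e S₂ T)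
  (hadd₂ : ∀ S T₁ T₂, e S (T₁ + T₂) = e S T₁ * e S T₂)
  (hgal : ∀ (σ : absoluteGaloisGroup K) (S T : W.geomTorsion ((p ^ J : ℕ) : ℤ)), σ • e S T = e (σ • S) (σ • T))
  (hnondeg : ∀ T, (∀ S, e S T = 1) → T = 0)
  [Finite (W.geomTorsion ((p ^ J : ℕ) : ℤ))]

omit [CharZero K] [W.IsElliptic] [Finite (W.geomTorsion ((p ^ J : ℕ) : ℤ))] in
/-- Bilinearity of the additive Weil pairing in both arguments for integer multiples:
`⟨c • S, T⟩ = ⟨S, c • T⟩`. [cite: SilvermanAEC2009, Prop. III.8.1 (a)] -/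
private theorem weilPairingHom_zsmul_left_eq_right (c : ℤ) (S T : W.geomTorsion ((p ^ J : ℕ) : ℤ)) :
    haveI := neZero_prime_pow p J
    weilPairingHom W (p ^ J) e hμ hadd₁ hadd₂ (c • S) T = weilPairingHom W (p ^ J) e hμ hadd₁ hadd₂ S (c • T) := by
  rw [map_zsmul, map_zsmul, AddMonoidHom.zsmul_apply]

include hu' huu' hμ hadd₁ hadd₂ hgal hnondeg in
/-- **No twisted invariants in `Hom(ker π, μ)`** (the hypothesis `hinv` of `map_twistedTorsionInclDual_eq_zero_of_smul_eq_zero`):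
granted a non-degenerate Galois-equivariant Weil pairing on `E[p^J]`, `u u' ≡ 1 (mod p^J)`, the divisibility of `E(K̄)` and the
vanishing of the `Gal(K̄/K_∞)`-fixed points of `E[p^J]`, every `m ∈ Hom(E[p^J], μ_{p^J})` whose restriction to `ker π` is invariant
under the Tate-dual action of `Γ_K` on `E[p^J](χ_u)^D` vanishes on `ker π`. [cite: GreenbergLNM1716, §4 pp. 123–124]
[cite: SilvermanAEC2009, Prop. III.8.1] -/
theorem forall_apply_eq_zero_of_tateDual_sub_apply_eq_zero (hdiv : W.zsmul_geomPoints_surjective)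
    (hfix : ∀ T : W.geomTorsion ((p ^ J : ℕ) : ℤ), (∀ h : absoluteGaloisGroup K, h ∈ κ.kerSubgroup → h • T = T) → T = 0)
    (m : TateDual K (W.geomTorsion ((p ^ J : ℕ) : ℤ)) (p ^ J))
    (hm : ∀ (g : absoluteGaloisGroup K) (R : W.geomTorsion ((p ^ J : ℕ) : ℤ)), W.twistedTorsionMulPow p κ hjJ u hu R = 0 →
      ((W.twistedTorsionGaloisModule p κ J u hu).tateDual (p ^ J) g m - m) R = 0)
    (R : W.geomTorsion ((p ^ J : ℕ) : ℤ)) (hR : W.twistedTorsionMulPow p κ hjJ u hu R = 0) : m R = 0 := by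
  haveI := neZero_prime_pow p J
  -- `m = w T`
  obtain ⟨T, rfl⟩ := (W.twistedWeilDual_bijective p κ J hu hu' huu' e hμ hadd₁ hadd₂ hgal hnondeg).2 m
  -- `w` intertwines the `χ_{u'}`-twisted action with the Tate-dual action
  have hwint : ∀ (g : absoluteGaloisGroup K) (Q : W.geomTorsion ((p ^ J : ℕ) : ℤ)),
      (W.twistedTorsionGaloisModule p κ J u hu).tateDual (p ^ J) g
          (W.twistedWeilDual p κ J hu hu' huu' e hμ hadd₁ hadd₂ hgal Q) =
        W.twistedWeilDual p κ J hu hu' huu' e hμ hadd₁ hadd₂ hgal (W.twistedTorsionGaloisModule p κ J u' hu' g Q) :=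
    fun g Q ↦ by
    have h := ContinuousLinearMap.ext_iff.1
      ((W.twistedWeilDual p κ J hu hu' huu' e hμ hadd₁ hadd₂ hgal).isIntertwining' g) Q
    exact h.symm
  -- `p^j` kills every `E[p^J]`-point `Q` that pairs trivially with `ker π`
  have hkill : ∀ Q : W.geomTorsion ((p ^ J : ℕ) : ℤ),
      (∀ R : W.geomTorsion ((p ^ J : ℕ) : ℤ), W.twistedTorsionMulPow p κ hjJ u hu R = 0 →
        weilPairingHom W (p ^ J) e hμ hadd₁ hadd₂ R Q = 0) →
      ((p ^ j : ℕ) : ℤ) • Q = 0 := by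
    intro Q hQ
    apply weilDualHom_injective W (p ^ J) e hμ hadd₁ hadd₂ hnondeg
    rw [map_zero]
    refine TateDual.ext fun S ↦ ?_
    rw [weilDualHom_apply_apply, ← weilPairingHom_zsmul_left_eq_right W p e hμ hadd₁ hadd₂]
    refine hQ _ ?_
    rw [twistedTorsionMulPow_apply_eq_zero_iff, smul_smul, ← Nat.cast_mul, ← pow_add, Nat.sub_add_cancel hjJ,
      natCast_zsmul]
    exact W.pow_nsmul_geomTorsion_pow p J S
  -- step 1: `p^j (g★T − T) = 0` for every `g`
  have h1 : ∀ g : absoluteGaloisGroup K,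
      ((p ^ j : ℕ) : ℤ) • (W.twistedTorsionGaloisModule p κ J u' hu' g T - T) = 0 := by
    intro g
    refine hkill _ fun R hR' ↦ ?_
    have h := hm g R hR'
    rw [hwint, ← map_sub] at h
    rw [← twistedWeilDual_apply_apply W p κ J hu hu' huu' e hμ hadd₁ hadd₂ hgal]
    exact h
  -- step 2: `p^j T` is fixed by `Gal(K̄/K_∞)`, hence `0`
  have h2 : ((p ^ j : ℕ) : ℤ) • T = 0 := by
    refine hfix _ fun h hh ↦ ?_
    have h' := h1 h
    rw [smul_sub, sub_eq_zero] at h'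
    have hact : W.twistedTorsionGaloisModule p κ J u' hu' h T = h • T := by
      rw [ZpExtension.galoisTwist_apply_of_mem_kerSubgroup _ _ _ _ _ _ hh, torsionGaloisModule_apply_apply]
    rw [hact, smul_comm] at h'
    exact h'
  -- step 3: `m R = e(R, T) = e(p^j R₁, T) = e(R₁, p^j T) = 1`
  obtain ⟨R₁, rfl⟩ := W.exists_eq_pow_smul_of_twistedTorsionMulPow_eq_zero p κ hjJ u hu hdiv hR
  rw [twistedWeilDual_apply_apply, weilPairingHom_zsmul_left_eq_right W p e hμ hadd₁ hadd₂, h2]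
  exact map_zero _

end WeierstrassCurve

end
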